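import Summits.AnomalousDissipation.AnomalousDissipation.Theorems.BaireTransferRobustLoudUpgradeLinePeriodicDefs4
import Summits.AnomalousDissipation.AnomalousDissipation.Theorems.BaireTransferRobustLoudUpgradeStubScalingCrossingClosure
import Summits.AnomalousDissipation.AnomalousDissipation.Theorems.BaireTransferRobustLoudUpgradeStubScalingCrossingClosurePeriodic
import Summits.AnomalousDissipation.AnomalousDissipation.Theorems.BaireTransferRobustLoudUpgradeStubRadialSteady
import Summits.AnomalousDissipation.AnomalousDissipation.Theorems.BaireTransferRobustLoudUpgradeStubRadialPeriodic

/-!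
# Line `malkin-cone-group-orbits`, companion c4 ("THE VISCOSITY UNFOLDING"): the scaling-crossing and radial classes,
# the tame union `tameScaling`, and the line glue (crux `BaireTransfer.RobustLoudUpgrade`, stmt-AnomalousDissipation-1144)

Definitions + glue (reviewed for the five definitions).  `LOUD` quantifies `∃ ν < a`; the parabolic NS scaling
`(u, p, ν, f) ↦ (αu(α·), α²p(α·), αν, α²f)` (landed: `Scaling.scaling_mem_loud` p127695) identifies the free viscosity with the RADIAL
force direction `c ↦ α²c`.  The tame classes of v2–c3 persist witnesses at ONE viscosity; the companion c4 sweeps the hypersurfaces of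
forces they reach by dilations:

* `scalingCrossingSteady` / `scalingCrossingPeriodic` (interfaces of the engines E′): c2/c3's robust-crossing interfaces with the sign
  change of the Lyapunov–Schmidt function asked on the SHEET `(s, x) ↦ σ(s • c₁, x)` near `(1, 0)` at forces `c₁ → c`; TAME by the landed
  Pi-form engines `ScalingCrossing.stub_scalingCrossingClosure` (p128368) and `…Periodic` (p128316): IVT on the sheet of a nearby force
  `c′` gives a witness of `f_{s⋆c′}` at `ν`, and the scaling with `α = (√s⋆)⁻¹` makes it a witness of `f_{c′}` at viscosity `αν` —
  a ball around `c₁` is loud.  They contain `robustCrossingSteady` / `robustCrossingPeriodic` (`s₁ = s₂ = 1`).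
* `radialSteady` / `radialPeriodic` (class R): simply degenerate steady (resp. genuinely time-dependent periodic, free-period kernel
  `{∂ₜu, v}`) witnesses for which the force ITSELF is first-order visible — `f_c ∉ range L(ν,u₀)` (resp. `f_c + β∂ₜu` never solvable),
  equivalently `⟨w*, A u₀⟩ ≠ 0`: the branch of the FIXED force has a FOLD IN THE REYNOLDS NUMBER at the witness.  By the landed
  `ScalingCrossing.stub_radialSteady` (p128334; `LsFamily.stub_lsFamily` with border `h := f_c`) and `ScalingCrossing.stub_radialPeriodic`
  (p127986; `LsFamilyPeriodic.stub_lsFamilyPeriodic` with border `H := f_c`) the LS function changes sign along the ray `s ↦ σ(s • c, 0)`: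
  scaling crossings at `c` itself — no fold coefficient, no isolation, no symmetry, every `S`.
* `tameScaling := tamePeriodic4 ∪ scalingCrossingSteady ∪ scalingCrossingPeriodic ∪ radialSteady ∪ radialPeriodic ⊆ closure (interior LOUD)`;
  `line_glue_c4` (registered): the residual over `tameScaling` proves the crux BY NAME.

References: Chow–Hale 1982 Ch. 6; Kielhöfer 2012 §I.4–I.5, §I.12–I.13; the route file (item 1144);
`Cruxes/RobustLoudUpgrade/Lines/malkin_cone_group_orbits_c4.lean` (the checked skeleton of this companion); `Cruxes/RobustLoudUpgrade/Disproof.lean` §9.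
-/

-- `Summit.<Summit>.<Problem>` is the tree's mandated summit-side namespace (CONVENTIONS §2); for this
-- single-conjunct summit the two coincide, so the duplicate is deliberate.
set_option linter.dupNamespace false

noncomputable section

open scoped BigOperators Topology
open Filter Set Function TopologicalSpace MeasureTheory

namespace Summit.AnomalousDissipation.AnomalousDissipation.Theorems.RobustLoudUpgrade

open Literature.Analysis.FunctionSpaces Literature.Analysis.FunctionSpaces.Torus
open Literature.Analysis.FluidPDE
open Summit.AnomalousDissipation.AnomalousDissipation.Theses.BaireTransfer

/-! ## §1 The classes of the companion c4 -/

/-- **Scaling-crossing steady witnesses** (interface of engine E′, steady).  As c2's `robustCrossingSteady`, except that the sign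
change of the Lyapunov–Schmidt function is asked on the SHEET `(s, x) ↦ σ(s • c₁, x)` near `(1, 0)` (dilations of the force are
free because the viscosity is free in `LOUD`), at forces `c₁` arbitrarily close to `c`. [folklore] -/
def scalingCrossingSteady (S : Finset (Fin 3 → ℤ)) (a E ε : ℝ) : Set (Coeff S) :=
  {c | ∃ ν : ℝ, 0 < ν ∧ ν < a ∧ ∃ (u₀ : UnitAddTorus (Fin 3) → EuclideanSpace ℝ (Fin 3)) (p₀ : UnitAddTorus (Fin 3) → ℝ),
    Torus.IsSteadyNSState ν (force S c) u₀ p₀ ∧ HasZeroMean u₀ ∧ meanEnergy (fun _ : ℝ => u₀) < E ∧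
      ε < meanDissipation ν (fun _ : ℝ => u₀) ∧
      ∃ σ : Coeff S × ℝ → ℝ,
        (∀ δ : ℝ, 0 < δ → ∃ r : ℝ, 0 < r ∧ ContinuousOn σ (Metric.ball (c, (0 : ℝ)) r) ∧
          ∀ q ∈ Metric.ball (c, (0 : ℝ)) r, σ q = 0 →
            ∃ (u' : UnitAddTorus (Fin 3) → EuclideanSpace ℝ (Fin 3)) (p' : UnitAddTorus (Fin 3) → ℝ),
              Torus.IsSteadyNSState ν (force S q.1) u' p' ∧ HasZeroMean u' ∧ h1DistSq u' u₀ < δ) ∧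
        ∀ η : ℝ, 0 < η → ∃ (c₁ : Coeff S) (s₁ s₂ x₁ x₂ : ℝ), dist c₁ c < η ∧ |s₁ - 1| < η ∧ |s₂ - 1| < η ∧
          |x₁| < η ∧ |x₂| < η ∧ σ (s₁ • c₁, x₁) < 0 ∧ 0 < σ (s₂ • c₁, x₂)}

/-- **Scaling-crossing periodic witnesses** (interface of engine E′, periodic twin). [folklore] -/
def scalingCrossingPeriodic (S : Finset (Fin 3 → ℤ)) (a E ε : ℝ) : Set (Coeff S) :=
  {c | ∃ ν : ℝ, 0 < ν ∧ ν < a ∧ ∃ (τ : ℝ) (u : ℝ → UnitAddTorus (Fin 3) → EuclideanSpace ℝ (Fin 3))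
      (p : ℝ → UnitAddTorus (Fin 3) → ℝ), 0 < τ ∧
    IsClassicalNSSolutionOn Set.univ ν (fun _ => force S c) u p ∧ Function.Periodic u τ ∧
      meanEnergy u < E ∧ ε < meanDissipation ν u ∧
      ∃ σ : Coeff S × ℝ → ℝ,
        (∀ δ : ℝ, 0 < δ → ∃ r : ℝ, 0 < r ∧ ContinuousOn σ (Metric.ball (c, (0 : ℝ)) r) ∧
          ∀ q ∈ Metric.ball (c, (0 : ℝ)) r, σ q = 0 →
            ∃ (τ' : ℝ) (u' : ℝ → UnitAddTorus (Fin 3) → EuclideanSpace ℝ (Fin 3)) (p' : ℝ → UnitAddTorus (Fin 3) → ℝ),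
              0 < τ' ∧ IsClassicalNSSolutionOn Set.univ ν (fun _ => force S q.1) u' p' ∧ Function.Periodic u' τ' ∧
              ∀ t, (∫ x, ‖u' t x - u (τ / τ' * t) x‖ ^ 2) + gradNormSq (fun x => u' t x - u (τ / τ' * t) x) ≤ δ) ∧
        ∀ η : ℝ, 0 < η → ∃ (c₁ : Coeff S) (s₁ s₂ x₁ x₂ : ℝ), dist c₁ c < η ∧ |s₁ - 1| < η ∧ |s₂ - 1| < η ∧
          |x₁| < η ∧ |x₂| < η ∧ σ (s₁ • c₁, x₁) < 0 ∧ 0 < σ (s₂ • c₁, x₂)}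

/-- **Radially visible simply degenerate steady witnesses** (class R, steady): a mean-zero classical steady witness with strict
budgets whose classical mean-zero kernel lies on one complex line `ℂ·v` and for which the force ITSELF is first-order visible,
`f_c ∉ range L(ν,u₀)` — equivalently `⟨w*, A u₀⟩ ≠ 0`: the branch of the fixed force `f_c` has a fold in the viscosity at
`(ν, u₀)`.  No fold coefficient, no isolation, no symmetry is asked. [folklore] -/
def radialSteady (S : Finset (Fin 3 → ℤ)) (a E ε : ℝ) : Set (Coeff S) :=
  {c | ∃ ν : ℝ, 0 < ν ∧ ν < a ∧ ∃ (u₀ : UnitAddTorus (Fin 3) → EuclideanSpace ℝ (Fin 3)) (p₀ : UnitAddTorus (Fin 3) → ℝ),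
    Torus.IsSteadyNSState ν (force S c) u₀ p₀ ∧ HasZeroMean u₀ ∧ meanEnergy (fun _ : ℝ => u₀) < E ∧
      ε < meanDissipation ν (fun _ : ℝ => u₀) ∧
      ∃ v : UnitAddTorus (Fin 3) → EuclideanSpace ℝ (Fin 3), IsSmooth v ∧ IsDivFree v ∧ HasZeroMean v ∧
        (∀ w, Torus.LinNSResolventRel ν u₀ 0 w 0 → ∃ z : ℂ, w = z • cplx v) ∧
        ∀ w, ¬ Torus.LinNSResolventRel ν u₀ 0 w (cplx (force S c))}

/-- **Radially visible simply degenerate periodic witnesses** (class R, periodic): a genuinely time-dependent `τ`-periodic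
classical witness with strict budgets, free-period kernel `{∂ₜu, v}` simple (c3's hypotheses verbatim), for which the steady
forcing `f_c` (plus any multiple of `∂ₜu`) is never in the range of the linearised periodic problem — the orbit of the fixed
force has a fold in the viscosity. [folklore] -/
def radialPeriodic (S : Finset (Fin 3 → ℤ)) (a E ε : ℝ) : Set (Coeff S) :=
  {c | ∃ ν : ℝ, 0 < ν ∧ ν < a ∧ ∃ (τ : ℝ) (u : ℝ → UnitAddTorus (Fin 3) → EuclideanSpace ℝ (Fin 3))
      (p : ℝ → UnitAddTorus (Fin 3) → ℝ), 0 < τ ∧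
    IsClassicalNSSolutionOn Set.univ ν (fun _ => force S c) u p ∧ Function.Periodic u τ ∧
      meanEnergy u < E ∧ ε < meanDissipation ν u ∧
      (∃ t x, Torus.timeDerivWithin Set.univ u t x ≠ 0) ∧
      ∃ v : ℝ → UnitAddTorus (Fin 3) → EuclideanSpace ℝ (Fin 3), IsSmoothSpaceTimeOn Set.univ v ∧ Function.Periodic v τ ∧
        (∀ t, IsDivFree (v t)) ∧ (∀ t, HasZeroMean (v t)) ∧
        (¬ ∃ z : ℂ, ∀ t x, Torus.realToComplex (v t x) = z • velocityDot u t x) ∧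
        (∀ (w : ℝ → UnitAddTorus (Fin 3) → EuclideanSpace ℂ (Fin 3)) (β : ℂ),
          w ∈ linPeriodicSol ν u τ (fun t x => β • velocityDot u t x) →
            ∃ z₁ z₂ : ℂ, ∀ t x, w t x = z₁ • velocityDot u t x + z₂ • Torus.realToComplex (v t x)) ∧
        ∀ β : ℂ, linPeriodicSol ν u τ (fun t x => β • velocityDot u t x + cplx (force S c) x) = ∅}

/-- The tame union of the companion c4: c3's `tamePeriodic4` plus the two scaling-crossing and the two radial classes. [folklore] -/
def tameScaling (S : Finset (Fin 3 → ℤ)) (a E ε : ℝ) : Set (Coeff S) :=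
  tamePeriodic4 S a E ε ∪ scalingCrossingSteady S a E ε ∪ scalingCrossingPeriodic S a E ε ∪ radialSteady S a E ε ∪
    radialPeriodic S a E ε

namespace ScalingCrossing

/-! ## §2 Glue (sorry-free): the classes are tame; the residual over `tameScaling` proves the crux BY NAME -/

/-- c2's robust crossings are scaling crossings (`s₁ = s₂ = 1`; registered sanity sub-goal). [folklore] -/
theorem robustCrossingSteady_subset_scalingCrossingSteady : ∀ (S : Finset (Fin 3 → ℤ)) (a E ε : ℝ), robustCrossingSteady S a E ε ⊆ scalingCrossingSteady S a E ε := by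
  intro S a E ε c hc
  obtain ⟨ν, hν, hνa, u₀, p₀, hst, h0, hE, hε, σ, hfam, hsign⟩ := hc
  refine ⟨ν, hν, hνa, u₀, p₀, hst, h0, hE, hε, σ, hfam, fun η hη => ?_⟩
  obtain ⟨c₁, x₁, x₂, hc₁, hx₁, hx₂, hs₁, hs₂⟩ := hsign η hη
  exact ⟨c₁, 1, 1, x₁, x₂, hc₁, by simpa using hη, by simpa using hη, hx₁, hx₂, by simpa using hs₁, by simpa using hs₂⟩

/-- c3's robust periodic crossings are periodic scaling crossings (`s₁ = s₂ = 1`; registered sanity sub-goal). [folklore] -/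
theorem robustCrossingPeriodic_subset_scalingCrossingPeriodic : ∀ (S : Finset (Fin 3 → ℤ)) (a E ε : ℝ), robustCrossingPeriodic S a E ε ⊆ scalingCrossingPeriodic S a E ε := by
  intro S a E ε c hc
  obtain ⟨ν, hν, hνa, τ, u, p, hτ, hsol, hper, hE, hε, σ, hfam, hsign⟩ := hc
  refine ⟨ν, hν, hνa, τ, u, p, hτ, hsol, hper, hE, hε, σ, hfam, fun η hη => ?_⟩
  obtain ⟨c₁, x₁, x₂, hc₁, hx₁, hx₂, hs₁, hs₂⟩ := hsign η hη
  exact ⟨c₁, 1, 1, x₁, x₂, hc₁, by simpa using hη, by simpa using hη, hx₁, hx₂, by simpa using hs₁, by simpa using hs₂⟩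

/-- **(E′, steady)** `scalingCrossingSteady ⊆ closure (interior LOUD)` at the same strict budgets. [folklore] -/
theorem scalingCrossingSteady_subset_closure_interior_loud (S : Finset (Fin 3 → ℤ)) (a E ε : ℝ) :
    scalingCrossingSteady S a E ε ⊆ closure (interior (loud S a E ε)) := by
  intro c hc
  obtain ⟨ν, hν, hνa, u₀, p₀, hst, -, hE, hε, σ, hfam, hsign⟩ := hc
  refine stub_scalingCrossingClosure S a E ε c ν u₀ p₀ σ hν hνa hst hE hε (fun δ hδ => ?_) hsign
  obtain ⟨r, hr, hcont, hz⟩ := hfam δ hδ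
  exact ⟨r, hr, hcont, fun q hq h0 => by
    obtain ⟨u', p', hst', -, hd⟩ := hz q hq h0
    exact ⟨u', p', hst', hd⟩⟩

/-- **(E′, periodic)** `scalingCrossingPeriodic ⊆ closure (interior LOUD)` at the same strict budgets. [folklore] -/
theorem scalingCrossingPeriodic_subset_closure_interior_loud (S : Finset (Fin 3 → ℤ)) (a E ε : ℝ) :
    scalingCrossingPeriodic S a E ε ⊆ closure (interior (loud S a E ε)) := by
  intro c hc
  obtain ⟨ν, hν, hνa, τ, u, p, hτ, hsol, hper, hE, hε, σ, hfam, hsign⟩ := hc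
  exact stub_scalingCrossingClosurePeriodic S a E ε c ν τ u p σ hν hνa hτ hsol hper hE hε hfam hsign

/-- **(R, steady)** `radialSteady ⊆ scalingCrossingSteady` (sign change along the ray of `c` itself: `c₁ = c`, `x₁ = x₂ = 0`).
[folklore] -/
theorem radialSteady_subset_scalingCrossingSteady (S : Finset (Fin 3 → ℤ)) (a E ε : ℝ) :
    radialSteady S a E ε ⊆ scalingCrossingSteady S a E ε := by
  intro c hc
  obtain ⟨ν, hν, hνa, u₀, p₀, hst, h0, hE, hε, v, hv₁, hv₂, hv₃, hker, hvis⟩ := hc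
  obtain ⟨σ, hfam, hray⟩ := stub_radialSteady S c ν u₀ p₀ v hν hst h0 hv₁ hv₂ hv₃ hker hvis
  refine ⟨ν, hν, hνa, u₀, p₀, hst, h0, hE, hε, σ, hfam, fun η hη => ?_⟩
  obtain ⟨s₁, s₂, hs₁, hs₂, hσ₁, hσ₂⟩ := hray η hη
  exact ⟨c, s₁, s₂, 0, 0, by rw [dist_self]; exact hη, hs₁, hs₂, by simpa using hη, by simpa using hη, hσ₁, hσ₂⟩

/-- **(R, periodic)** `radialPeriodic ⊆ scalingCrossingPeriodic`. [folklore] -/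
theorem radialPeriodic_subset_scalingCrossingPeriodic (S : Finset (Fin 3 → ℤ)) (a E ε : ℝ) :
    radialPeriodic S a E ε ⊆ scalingCrossingPeriodic S a E ε := by
  intro c hc
  obtain ⟨ν, hν, hνa, τ, u, p, hτ, hsol, hper, hE, hε, hmov, v, hsv, hperv, hvdiv, hv0, hdeg, hker, hvis⟩ := hc
  obtain ⟨σ, hfam, hray⟩ :=
    stub_radialPeriodic S c ν τ u p v hν hτ hsol hper hmov hsv hperv hvdiv hv0 hdeg hker hvis
  refine ⟨ν, hν, hνa, τ, u, p, hτ, hsol, hper, hE, hε, σ, hfam, fun η hη => ?_⟩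
  obtain ⟨s₁, s₂, hs₁, hs₂, hσ₁, hσ₂⟩ := hray η hη
  exact ⟨c, s₁, s₂, 0, 0, by rw [dist_self]; exact hη, hs₁, hs₂, by simpa using hη, by simpa using hη, hσ₁, hσ₂⟩

/-- **The tame union of the companion c4 is force-open up to closure.** [folklore] -/
theorem tameScaling_subset_closure_interior_loud (S : Finset (Fin 3 → ℤ)) (a E ε : ℝ) :
    tameScaling S a E ε ⊆ closure (interior (loud S a E ε)) :=
  Set.union_subset
    (Set.union_subset
      (Set.union_subset
        (Set.union_subset (LsCrossingPeriodic.tamePeriodic4_subset_closure_interior_loud S a E ε)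
          (scalingCrossingSteady_subset_closure_interior_loud S a E ε))
        (scalingCrossingPeriodic_subset_closure_interior_loud S a E ε))
      ((radialSteady_subset_scalingCrossingSteady S a E ε).trans
        (scalingCrossingSteady_subset_closure_interior_loud S a E ε)))
    ((radialPeriodic_subset_scalingCrossingPeriodic S a E ε).trans
      (scalingCrossingPeriodic_subset_closure_interior_loud S a E ε))

/-- **Line glue of the companion c4 (registered sub-goal `line_glue_c4`)**: the residual over `tameScaling` proves the crux
`RobustLoudUpgrade` BY NAME (`LsCrossing.RobustLoudUpgrade_of_residual`). [folklore] -/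
theorem line_glue_c4 : (∀ S : Finset (Fin 3 → ℤ), unitStock ⊆ S → ∀ (a E ε : ℝ), 0 < a → 0 < ε → loud S a E ε ⊆ closure (tameScaling S a (2 * E) (ε / 2))) → RobustLoudUpgrade :=
  fun hRes => LsCrossing.RobustLoudUpgrade_of_residual (fun S a E ε => tameScaling S a E ε)
    tameScaling_subset_closure_interior_loud hRes

end ScalingCrossing

end Summit.AnomalousDissipation.AnomalousDissipation.Theorems.RobustLoudUpgrade

end
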